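import Mathlib
import Summits.NavierStokesRegularity.NavierStokesRegularity.Theorems.EulerZoomLiouvillePowerGaugeEulerLiouvilleSwirlfreeLedgerConfinement
import Literature.Analysis.ODE.EvolutionMapHomeomorph
import Literature.Analysis.FluidPDE.ReflectedGluedField
import Literature.Analysis.FluidPDE.SwirlTransportProofs
import Literature.Analysis.FluidPDE.FlatSwirlGauge
import HarnessLib

/-!
# Crux `EulerZoomLiouville.PowerGaugeEulerLiouville` (stmt-NavierStokesRegularity-19832), line `swirl-capacity`, stub D1:
# SWIRL BLOBS PERSIST BACKWARD (`stub_swirlBlobTransport`, signature unfolded)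

Route №10 `EulerZoomLiouville` (NavierStokesRegularity), crux E.  Line `swirl-capacity` (ideator ns-idea-11 g3;
`Cruxes/PowerGaugeEulerLiouville/Lines/swirl_capacity.lean`), registered stub `stub_swirlBlobTransport` (D1), proved here with its
signature UNFOLDED in the tree's vocabulary (the line's `IsAxiDriftingWith`, `SwirlBlobsPersist`,
`driftRadius M κ t₀ t₁ = M/(1−κ)·((−t₁)^{1−κ} − (−t₀)^{1−κ})` are `def`s of the Cruxes file; the statement below is their `δ`-unfolding,
so the skeleton fills the stub by `exact`).

THE STATEMENT.  Let `(u, p)` be a classical Euler solution on `(−∞,0) × ℝ³` with axisymmetric velocity and pressure slices and the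
velocity bound `‖u(τ,x)‖ ≤ M(−τ)^{−κ}` (`M ≥ 0`, `κ < 1`).  For `t₀ < 0`, an off-axis blob `B(x₀, δ)` (`0 < δ < r(x₀)`) on which the swirl
`Γ(t₀,·) = x₀u₁ − x₁u₀` satisfies `|Γ| ≥ γ₀`, and any earlier time `t₁ < t₀`, there is a measurable set
`T ⊆ B(0, ‖x₀‖ + δ + driftRadius M κ t₀ t₁)` on which `|Γ(t₁,·)| ≥ γ₀` and `vol B(x₀,δ) ≤ vol T`.

THE PROOF — the flow kit of the line `swirlfree-ledger` (`…SwirlfreeLedgerFlow` / `…SwirlfreeLedgerConfinement`) with the SWIRL CASIMIR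
in place of the ledger density: `T := φ(t₁, t₀, B(x₀,δ))` for the flow `φ` of the cut-off field `χ u` (`χ = 1` on `B̄(0, ‖x₀‖ + δ + drift + 1)`);
the backward displacement over `[t₁, t₀]` is `≤ driftRadius M κ t₀ t₁` (`norm_evolutionMap_sub_le`), so the parcels of the blob stay where
`χ = 1` and off the axis (`cylRadius_evolutionMap_ne_zero`); the swirl is MATERIALLY CONSERVED along them — Kelvin's theorem on material
circles, `D(r u_θ)/Dt = 0` for classical axisymmetric Euler (the tree's `swirl_transport_holds` at `ν = 0`, `f = 0`: the pressure term
`x₀∂₁p − x₁∂₀p = ∂_θ p` dies by axisymmetry of `p`) — so `|Γ(t₁,·)| ≥ γ₀` on `T` POINTWISE (`swirl_evolutionMap_eq`); `det Dφ = 1` on the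
blob (`det_fderiv_evolutionMap_eq_one_of_divergence`) and the change of variables (`lintegral_comp_evolutionMap_le` with `G = 1`)
transports the volume; `T` is measurable as the image of a ball under the evolution homeomorphism.

* `deriv_swirl_add_fderiv_swirl_eq_zero` — `∂ₜΓ(s,y) + DΓ(s)(y)[u(s,y)] = 0` off the axis (classical axisymmetric Euler);
* `differentiableAt_uncurry_swirl` — `(s,y) ↦ Γ(s,y)` is differentiable at interior times;
* `swirl_evolutionMap_eq` — `Γ` is conserved along confined off-axis trajectories of the cut-off flow;
* **`swirlBlobsPersist_of_axiDriftingWith`** — the stub signature, unfolded.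

WHAT THIS IS NOT: not NS, not the crux — a helper `--supports` stmt-19832 on the line `swirl-capacity` (a lemma about a hypothetical
class of ancient Euler solutions); no summit statement is proved here.
[cite: MajdaBertozziCUP2002, §2.3.3 (2.67) "D̃/Dt (r v^θ) = 0", §1.3 Prop. 1.4; KochNadirashviliSereginSverak2009, (1.8)]
-/

noncomputable section

-- flat `Theorems/<Route><Decl>…` files of one crux share the namespace of the crux (tree convention)
set_option linter.dupNamespace false

open MeasureTheory Set Filter Topology Metric Function
open scoped NNReal ENNReal ContDiff RealInnerProductSpace

namespace Summit.NavierStokesRegularity.NavierStokesRegularity.Theorems.PowerGaugeEulerLiouville.SwirlCapacity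

open Literature.Analysis Literature.Analysis.FluidPDE
open Summit.NavierStokesRegularity.NavierStokesRegularity.Theorems.PowerGaugeEulerLiouville.SwirlfreeLedger

variable {u : ℝ → EuclideanSpace ℝ (Fin 3) → EuclideanSpace ℝ (Fin 3)} {p : ℝ → EuclideanSpace ℝ (Fin 3) → ℝ} {S : Set ℝ}

/-! ### The swirl Casimir -/

/-- **Material conservation of the swirl, pointwise form**: for a classical Euler solution with axisymmetric velocity and pressure
slices on an open set of times `S`, at `s ∈ S` and off the axis, `∂ₜΓ(s, y) + DΓ(s)(y)[u(s, y)] = 0` — the tree's KNSS identity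
`swirl_transport_holds` (`∂ₜΓ + (u·∇)Γ = ν(ΔΓ − (2/r)∂ᵣΓ) + x₀f₁ − x₁f₀`) at `ν = 0`, `f = 0`.
[cite: MajdaBertozziCUP2002, §2.3.3 (2.67); KochNadirashviliSereginSverak2009, (1.8)] -/
theorem deriv_swirl_add_fderiv_swirl_eq_zero (hcl : IsClassicalEulerSolutionOn S 0 u p) (hSo : IsOpen S)
    (hax : ∀ s ∈ S, IsAxisymmetric (u s)) (hp : ∀ s ∈ S, IsAxisymmetricScalar (p s)) {s : ℝ} (hs : s ∈ S)
    {y : EuclideanSpace ℝ (Fin 3)} (hy : cylRadius y ≠ 0) :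
    deriv (fun r => swirl (u r) y) s + fderiv ℝ (swirl (u s)) y (u s y) = 0 := by
  have h := swirl_transport_holds hcl hax hp hs hy
  have h0 : swirl ((0 : ℝ → EuclideanSpace ℝ (Fin 3) → EuclideanSpace ℝ (Fin 3)) s) y = 0 := by simp [swirl]
  rw [h0, zero_mul, add_zero, timeDerivWithin_apply, derivWithin_of_isOpen hSo hs, convect_apply] at h
  exact h

/-- **The swirl is differentiable in space–time** at every `(s, y)` with `s` in the open set of times of a jointly smooth velocity
(`Γ(s,y) = ⟪Jy, u(s,y)⟫`, `IsSmoothSpaceTimeOn.contDiffOn_uncurry_swirl`). [folklore] -/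
theorem differentiableAt_uncurry_swirl (hu : IsSmoothSpaceTimeOn S u) (hSo : IsOpen S) {s : ℝ} (hs : s ∈ S)
    (y : EuclideanSpace ℝ (Fin 3)) :
    DifferentiableAt ℝ (uncurry fun (s : ℝ) (y : EuclideanSpace ℝ (Fin 3)) => swirl (u s) y) (s, y) := by
  have hmem : S ×ˢ (univ : Set (EuclideanSpace ℝ (Fin 3))) ∈ 𝓝 (s, y) :=
    (hSo.prod isOpen_univ).mem_nhds ⟨hs, mem_univ _⟩
  exact ((hu.contDiffOn_uncurry_swirl).differentiableOn (by norm_cast)).differentiableAt hmem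

/-- **The swirl is conserved along confined off-axis trajectories of the cut-off flow** (Kelvin's theorem on material circles).  Let
`(u, p)` be a classical Euler solution with axisymmetric velocity and pressure slices on an open convex set of times `S ∋ t₁ ≤ t₀`, `χ` a
bump about the origin and `φ` the flow of the cut-off field `w = χ u`.  If the trajectory through an off-axis `x` at time `t₀` stays,
during `[t₁, t₀]`, in the ball where `χ = 1`, then `Γ(t₁, φ(t₁,t₀,x)) = Γ(t₀, x)`: along the trajectory `w = u`, the trajectory avoids the
axis, so by the local chain rule and `deriv_swirl_add_fderiv_swirl_eq_zero` the composite has zero derivative on `[t₁, t₀]`.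
[cite: MajdaBertozziCUP2002, §2.3.3 (2.67) "the quantity r v^θ is conserved along particle trajectories"] -/
theorem swirl_evolutionMap_eq (hcl : IsClassicalEulerSolutionOn S 0 u p) (hSo : IsOpen S) (hS : Convex ℝ S)
    (hax : ∀ s ∈ S, IsAxisymmetric (u s)) (hp : ∀ s ∈ S, IsAxisymmetricScalar (p s))
    (χ : ContDiffBump (0 : EuclideanSpace ℝ (Fin 3))) {t₁ t₀ : ℝ} (ht₁ : t₁ ∈ S) (ht₀ : t₀ ∈ S) (h10 : t₁ ≤ t₀)
    {x : EuclideanSpace ℝ (Fin 3)} (hx : cylRadius x ≠ 0)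
    (hconf : ∀ s ∈ Icc t₁ t₀, ODE.evolutionMap (fun t z => χ z • u t z) t₀ s x ∈ ball (0 : EuclideanSpace ℝ (Fin 3)) χ.rIn) :
    swirl (u t₁) (ODE.evolutionMap (fun t z => χ z • u t z) t₀ t₁ x) = swirl (u t₀) x := by
  have hu : IsSmoothSpaceTimeOn S u := hcl.smooth_velocity
  have hL := isUniformlyLipschitzOn_bump_smul χ hSo hu
  have haxisw : ∀ s ∈ S, ∀ z : EuclideanSpace ℝ (Fin 3), z 0 = 0 → z 1 = 0 →
      (fun t z => χ z • u t z) s z 0 = 0 ∧ (fun t z => χ z • u t z) s z 1 = 0 := by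
    intro s hs z hz0 hz1
    have h := Wei2016.apply_zero_one_eq_zero_of_axis (hax s hs) hz0 hz1
    simp [h.1, h.2]
  set γ : ℝ → EuclideanSpace ℝ (Fin 3) := fun r => ODE.evolutionMap (fun t z => χ z • u t z) t₀ r x with hγ
  have hγoff : ∀ r ∈ S, cylRadius (γ r) ≠ 0 := fun r hr =>
    cylRadius_evolutionMap_ne_zero hL hS haxisw ht₀ hr hx
  have hγder : ∀ r ∈ S, HasDerivAt γ ((fun t z => χ z • u t z) r (γ r)) r := fun r hr =>
    hL.hasDerivAt_evolutionMap hS ht₀ (hSo.mem_nhds hr) x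
  have hIS : Icc t₁ t₀ ⊆ S := hS.ordConnected.out ht₁ ht₀
  -- the composite `g r = Γ(r, γ r)` has zero derivative on `[t₁, t₀]`
  set g : ℝ → ℝ := fun r => swirl (u r) (γ r) with hg
  have hgder : ∀ r ∈ Icc t₁ t₀, HasDerivAt g 0 r := by
    intro r hr
    have hrS : r ∈ S := hIS hr
    have hball := hconf r hr
    have hwu : (fun t z => χ z • u t z) r (γ r) = u r (γ r) := by
      show χ (γ r) • u r (γ r) = u r (γ r)
      rw [χ.one_of_mem_closedBall (ball_subset_closedBall hball), one_smul]
    have hdiff := differentiableAt_uncurry_swirl hu hSo hrS (γ r)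
    have h1 := hasDerivAt_uncurry_comp hdiff (hγder r hrS)
    have hpde := deriv_swirl_add_fderiv_swirl_eq_zero hcl hSo hax hp hrS (hγoff r hrS)
    rw [hwu] at h1
    exact h1.congr_deriv hpde
  have hgc : ContinuousOn g (Icc t₁ t₀) := fun r hr => (hgder r hr).continuousAt.continuousWithinAt
  have hconst := constant_of_has_deriv_right_zero hgc fun r hr => (hgder r (Ico_subset_Icc_self hr)).hasDerivWithinAt
  have h := hconst t₀ (right_mem_Icc.2 h10)
  have hγ0 : γ t₀ = x := ODE.evolutionMap_self _ t₀ x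
  simp only [hg, hγ0] at h
  exact h.symm

/-! ### The stub, unfolded -/

/-- **D1 `stub_swirlBlobTransport` of the line `swirl-capacity`, signature unfolded** (`IsAxiDriftingWith u p M κ`, `SwirlBlobsPersist u M κ`,
`driftRadius` are the line's abbreviations): swirl superlevel blobs of classical axisymmetric members with drift data `(M, κ)`, `κ < 1`,
persist backward with their level and their volume — see the module docstring.
[cite: MajdaBertozziCUP2002, §2.3.3 (2.67), §1.3 Prop. 1.4] -/
theorem swirlBlobsPersist_of_axiDriftingWith :
    ∀ (u : ℝ → EuclideanSpace ℝ (Fin 3) → EuclideanSpace ℝ (Fin 3)) (p : ℝ → EuclideanSpace ℝ (Fin 3) → ℝ) (M κ : ℝ),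
      (IsClassicalEulerSolutionOn (Set.Iio 0) 0 u p ∧
          (∀ τ : ℝ, τ < 0 → IsAxisymmetric (u τ) ∧ IsAxisymmetricScalar (p τ)) ∧
          0 ≤ M ∧ κ < 1 ∧ ∀ τ : ℝ, τ < 0 → ∀ x : EuclideanSpace ℝ (Fin 3), ‖u τ x‖ ≤ M * (-τ) ^ (-κ)) →
        ∀ t₀ : ℝ, t₀ < 0 → ∀ (x₀ : EuclideanSpace ℝ (Fin 3)) (δ γ₀ : ℝ), 0 < δ → δ < cylRadius x₀ →
          (∀ x ∈ ball x₀ δ, γ₀ ≤ |swirl (u t₀) x|) →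
          ∀ t₁ : ℝ, t₁ < t₀ →
            ∃ T : Set (EuclideanSpace ℝ (Fin 3)), MeasurableSet T ∧
              T ⊆ ball (0 : EuclideanSpace ℝ (Fin 3)) (‖x₀‖ + δ + M / (1 - κ) * ((-t₁) ^ (1 - κ) - (-t₀) ^ (1 - κ))) ∧
              (∀ x ∈ T, γ₀ ≤ |swirl (u t₁) x|) ∧ volume (ball x₀ δ) ≤ volume T := by
  intro u p M κ hstr t₀ ht₀ x₀ δ γ₀ hδ hδr hlev t₁ ht₁
  obtain ⟨hcl, hsym, hM, hκ, hbound⟩ := hstr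
  -- the drift radius is nonnegative
  set D : ℝ := M / (1 - κ) * ((-t₁) ^ (1 - κ) - (-t₀) ^ (1 - κ)) with hD
  have h1κ : 0 < 1 - κ := by linarith
  have hD0 : 0 ≤ D := by
    have h1 : (-t₀) ^ (1 - κ) ≤ (-t₁) ^ (1 - κ) := Real.rpow_le_rpow (by linarith) (by linarith) h1κ.le
    exact mul_nonneg (div_nonneg hM h1κ.le) (by linarith)
  -- the times
  set T : Set ℝ := Set.Ioo (t₁ - 1) (t₀ / 2) with hT
  have hTo : IsOpen T := isOpen_Ioo
  have hTc : Convex ℝ T := convex_Ioo _ _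
  have ht₀T : t₀ ∈ T := ⟨by linarith, by linarith⟩
  have ht₁T : t₁ ∈ T := ⟨by linarith, by linarith⟩
  have hTneg : T ⊆ Set.Iio 0 := fun s hs => lt_trans hs.2 (by linarith)
  have hclT : IsClassicalEulerSolutionOn T 0 u p := hcl.mono hTneg hTo.uniqueDiffOn
  have hsymT : ∀ s ∈ T, IsAxisymmetric (u s) := fun s hs => (hsym s (hTneg hs)).1
  have hpT : ∀ s ∈ T, IsAxisymmetricScalar (p s) := fun s hs => (hsym s (hTneg hs)).2
  -- the cut-off flow
  set Rc : ℝ := ‖x₀‖ + δ + D with hRc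
  have hRc0 : 0 < Rc := by rw [hRc]; have := norm_nonneg x₀; linarith
  set χ : ContDiffBump (0 : EuclideanSpace ℝ (Fin 3)) := ⟨Rc + 1, Rc + 2, by linarith, by linarith⟩ with hχ
  have hrIn : χ.rIn = Rc + 1 := rfl
  have hwsmooth : IsSmoothSpaceTimeOn T (fun t z => χ z • u t z) := isSmoothSpaceTimeOn_bump_smul χ hclT.smooth_velocity
  have hL : ODE.IsUniformlyLipschitzOn (fun t z => χ z • u t z) T := isUniformlyLipschitzOn_bump_smul χ hTo hclT.smooth_velocity
  have hspeed : ∀ s ∈ Icc t₁ t₀, ∀ y, ‖(fun t z => χ z • u t z) s y‖ ≤ M * (-s) ^ (-κ) := fun s hs y =>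
    (norm_bump_smul_le χ (u s) y).trans (hbound s (by linarith [hs.2]) y)
  -- confinement of the parcels of the blob
  have hconf : ∀ x ∈ ball x₀ δ, ∀ s ∈ Icc t₁ t₀, ‖ODE.evolutionMap (fun t z => χ z • u t z) t₀ s x‖ < Rc := by
    intro x hx s hs
    have hd := norm_evolutionMap_sub_le hL hTc hTo ht₁T ht₀T ht₀ hκ hspeed x hs
    have h1 : (-s) ^ (1 - κ) ≤ (-t₁) ^ (1 - κ) := Real.rpow_le_rpow (by linarith [hs.2]) (by linarith [hs.1]) h1κ.le
    have h2 : M / (1 - κ) * ((-s) ^ (1 - κ) - (-t₀) ^ (1 - κ)) ≤ D := by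
      rw [hD]; exact mul_le_mul_of_nonneg_left (by linarith) (div_nonneg hM h1κ.le)
    have hxn : ‖x‖ < ‖x₀‖ + δ := by
      have := norm_le_norm_add_norm_sub' x x₀
      have hx' : ‖x - x₀‖ < δ := by rwa [mem_ball_iff_norm] at hx
      linarith
    calc ‖ODE.evolutionMap (fun t z => χ z • u t z) t₀ s x‖
        ≤ ‖x‖ + ‖ODE.evolutionMap (fun t z => χ z • u t z) t₀ s x - x‖ := norm_le_norm_add_norm_sub' _ _
      _ < ‖x₀‖ + δ + D := add_lt_add_of_lt_of_le hxn (hd.trans h2)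
  have hconf_in : ∀ x ∈ ball x₀ δ, ∀ s ∈ Icc t₁ t₀,
      ODE.evolutionMap (fun t z => χ z • u t z) t₀ s x ∈ ball (0 : EuclideanSpace ℝ (Fin 3)) χ.rIn := by
    intro x hx s hs
    rw [mem_ball_zero_iff, hrIn]
    linarith [hconf x hx s hs]
  -- the blob is off the axis
  have hoff : ∀ x ∈ ball x₀ δ, cylRadius x ≠ 0 := by
    intro x hx
    have h1 := cylRadius_sub_le_norm_sub x₀ x
    have h2 : ‖x₀ - x‖ < δ := by rw [← dist_eq_norm, dist_comm]; exact mem_ball.1 hx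
    intro h0
    rw [h0] at h1
    linarith
  -- incompressibility along confined trajectories
  have hdet : ∀ x ∈ ball x₀ δ, (fderiv ℝ (ODE.evolutionMap (fun t z => χ z • u t z) t₀ t₁) x).det = 1 := by
    intro x hx
    refine det_fderiv_evolutionMap_eq_one_of_divergence hL hwsmooth hTc hTo.uniqueDiffOn ht₀T ht₁T x fun s hs => ?_
    rw [uIcc_of_ge ht₁.le] at hs
    have hsT : s ∈ T := hTc.ordConnected.out ht₁T ht₀T hs
    have hball := hconf_in x hx s hs
    have h0 := hclT.divFree s hsT (ODE.evolutionMap (fun t z => χ z • u t z) t₀ s x)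
    unfold VectorCalculus.divergence at h0 ⊢
    rwa [fderiv_bump_smul_eq χ (u s) hball]
  -- the avatar
  set Φ := ODE.evolutionMap (fun t z => χ z • u t z) t₀ t₁ with hΦ
  have hcas : ∀ x ∈ ball x₀ δ, swirl (u t₁) (Φ x) = swirl (u t₀) x := fun x hx =>
    swirl_evolutionMap_eq hclT hTo hTc hsymT hpT χ ht₁T ht₀T ht₁.le (hoff x hx) (hconf_in x hx)
  refine ⟨Φ '' ball x₀ δ, hL.measurableSet_image_evolutionMap hTc ht₀T ht₁T measurableSet_ball, ?_, ?_, ?_⟩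
  · rintro y ⟨x, hx, rfl⟩
    exact mem_ball_zero_iff.2 (hconf x hx t₁ (left_mem_Icc.2 ht₁.le))
  · rintro y ⟨x, hx, rfl⟩
    rw [hcas x hx]
    exact hlev x hx
  · have hmaps : MapsTo Φ (ball x₀ δ) (Φ '' ball x₀ δ) := mapsTo_image Φ _
    have hcv := lintegral_comp_evolutionMap_le hL hwsmooth hTc hTo.uniqueDiffOn ht₀T ht₁T measurableSet_ball hdet hmaps
      (fun _ => (1 : ℝ≥0∞))
    simpa only [setLIntegral_one] using hcv

end Summit.NavierStokesRegularity.NavierStokesRegularity.Theorems.PowerGaugeEulerLiouville.SwirlCapacity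

end
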